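import Summits.CriticalPhenomena.Ising3D.ExclusionSentencesControl2DTrgGammaC7

/-!
# Exclusion sentences — 2D control, third datum `c = 1/2` vs the FULL `TRG` table at `10⁻⁷`, part 2 of 2
(cell `pub-ising3x`, seat recog-1, gen 6)

HONEST FRAMING: lottery ticket; floor = tightest certified 3D Ising CFT bounds; no exact-solution
claim without a proof.

Parts `4–7`, the assembled sentence `trgFull_control_c7` (exception list EMPTY) and the printed shape
`control_c7_not_trgFull`: a real within `10⁻⁷` of `1/2` is no member of the whole FAMILIES-v1 family `TRG`
(`D ≤ 17`, `h ≤ 32`).  See part 1, `ExclusionSentencesControl2DTrgGammaC7.lean`.  No 3D digit is used anywhere.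
-/

namespace Summit.CriticalPhenomena.Ising3D

/-- Part 4 (classes `Γ(¼)⁴`, `Γ(⅓)^{−3}`) of the full-TRG sentence on `[1/2 − 10⁻⁷, 1/2 + 10⁻⁷]`, empty list. -/
theorem trgFull_control_c7_p4 :
    trgFullPart 17 32 4 (1 / 2 - 1 / 10 ^ 7) (1 / 2 + 1 / 10 ^ 7) [] = true := by
  decide +kernel

/-- Part 5 (classes `Γ(⅓)^{−2}`, `Γ(⅓)^{−1}`) of the full-TRG sentence on `[1/2 − 10⁻⁷, 1/2 + 10⁻⁷]`, empty list. -/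
theorem trgFull_control_c7_p5 :
    trgFullPart 17 32 5 (1 / 2 - 1 / 10 ^ 7) (1 / 2 + 1 / 10 ^ 7) [] = true := by
  decide +kernel

/-- Part 6 (classes `Γ(⅓)¹`, `Γ(⅓)²`) of the full-TRG sentence on `[1/2 − 10⁻⁷, 1/2 + 10⁻⁷]`, empty list. -/
theorem trgFull_control_c7_p6 :
    trgFullPart 17 32 6 (1 / 2 - 1 / 10 ^ 7) (1 / 2 + 1 / 10 ^ 7) [] = true := by
  decide +kernel

/-- Part 7 (class `Γ(⅓)³`) of the full-TRG sentence on `[1/2 − 10⁻⁷, 1/2 + 10⁻⁷]`, empty list. -/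
theorem trgFull_control_c7_p7 :
    trgFullPart 17 32 7 (1 / 2 - 1 / 10 ^ 7) (1 / 2 + 1 / 10 ^ 7) [] = true := by
  decide +kernel

/-- **Full-TRG sentence at the 2D control `c = 1/2`, width `10⁻⁷`**: the whole FAMILIES-v1 family `TRG`
(`D ≤ 17`, `h ≤ 32`) has NO member in `[1/2 − 10⁻⁷, 1/2 + 10⁻⁷]`. -/
theorem trgFull_control_c7 :
    trgFullExcluded 17 32 (1 / 2 - 1 / 10 ^ 7) (1 / 2 + 1 / 10 ^ 7) [] = true :=
  trgFullExcluded_of_parts trgFull_control_c7_p0 trgFull_control_c7_p1 trgFull_control_c7_p2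
    trgFull_control_c7_p3 trgFull_control_c7_p4 trgFull_control_c7_p5 trgFull_control_c7_p6
    trgFull_control_c7_p7

/-- Printed shape: a real within `10⁻⁷` of `1/2` is no member of the whole TRG table (`D ≤ 17`, `h ≤ 32`). -/
theorem control_c7_not_trgFull {x : ℝ}
    (hx : ((1 / 2 - 1 / 10 ^ 7 : ℚ) : ℝ) ≤ x ∧ x ≤ ((1 / 2 + 1 / 10 ^ 7 : ℚ) : ℝ)) : x ∉ trgFullFamily 17 32 := by
  intro hm
  obtain ⟨e, he, _⟩ := trgFullExcluded_sound trgFull_control_c7 hx hm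
  simp at he

/-- … in particular no member of the `Γ`-free table `trgFamily 17 32` (all five `L`). -/
theorem control_c7_not_trg {x : ℝ}
    (hx : ((1 / 2 - 1 / 10 ^ 7 : ℚ) : ℝ) ≤ x ∧ x ≤ ((1 / 2 + 1 / 10 ^ 7 : ℚ) : ℝ)) : x ∉ trgFamily 17 32 :=
  fun hm => control_c7_not_trgFull hx (trgFamily_subset_trgFullFamily 17 32 hm)

end Summit.CriticalPhenomena.Ising3D
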